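import Literature.Probability.RandomPlanarGeometry.YangBaxterSAWHexagon
import HarnessLib

/-!
# The column exchange by sliding a rhombus (Glazman–Manolescu, §4.2, Fig. 6–7)

Topic `Literature/Probability/RandomPlanarGeometry`; fifth support file for the discharge of the
named fact `Literature.Probability.RandomPlanarGeometry.SAW.YangBaxter.GlazmanManolescu2019_prop42`
(`YangBaxterSAWTwoPoint.lean`): A. Glazman, I. Manolescu, *Self-avoiding walk on `ℤ²` with
Yang–Baxter weights: universality of critical fugacity and 2-point function*, arXiv:1708.00395
(`GlazmanManolescu2019`), **§4.2, proof of Proposition 4.2**: "consider the rhombic tiling `D_0`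
obtained by adding a rhombus `r` to `Rect_{T,L}(Θ)` at the top of `i`-th and `i+1`-th columns …
Denote by `t_1, …, t_{2L+1}` the rhombi in `Rect_{T,L}(Θ)` in columns `i` and `i + 1` … Let `D_k`
be the rhombic tiling obtained from `D_0` after applying the Yang–Baxter transformation to `r` and
`t_1`, then to `r` and `t_2` etc, until `r` and `t_k`, … By Corollary 3.2, `G_{D_k}(a, b) =
G_{D_{k−1}}(a, b)`, for `1 ≤ k ≤ 2L`, hence `G_{D_0}(a, b) = G_{D_{2L}}(a, b)`."

## Contents (all proved; no named facts)

* `Cx.ofSides`: a rhombic complex (`YangBaxterSAWComplex.lean`) from a side table; `defCx Θ i h`: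
  **the defect tiling `D_h`** — the grid with the added rhombus `r` (angle `θ_{i+1} − θ_i`) between
  the rows `h − 1` and `h` of the double column `i, i+1`, the angles of the two columns exchanged
  above it (`dside`, `dangle`); `defCx_lawful`; its piece `defDom T L = Rect_{T,L} ∪ {r}`;
  the hexagon of one move (`moveH`, interior/boundary edges `moveInt`, `moveBd`) is a `Cx.SubCx`
  (`defCx_subCx`).
* **One Yang–Baxter move** (`wsum_defCx_eq_pred`): `G_{D_h} = G_{D_{h−1}}` on `defDom` for boundary
  points off column `i + 1`: after re-labelling two edges (`moveψ`, `moveCx`, `Cx.wsum_relabel`) the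
  tilings `D_h` and `D_{h−1}` agree off the hexagon, the hexagon of `D_h` is the image of `topHex`
  and that of `D_{h−1}` the image of `botHex` (`embTop`, `embBot`: `Cx.LocEmb`s of
  `YangBaxterSAWHexagon.lean`), so Corollary 3.2 (`Cx.wsum_eq_of_Zloc_eq`,
  `YangBaxterSAWGluing.lean`) and Proposition 3.1 (`Zloc_topHex_eq_botHex`) apply.
* `wsum_defCx_top_eq_bot`: the `2L + 1` moves, `G_{D_{L+1}} = G_{D_{−L}}`.

The ends of the sliding (comparison of `D_{L+1}`, `D_{−L}` with the rectangles), the limit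
`L → ∞` and the reduction of permutations to nearest-neighbour transpositions are in
`YangBaxterSAWTwoPointProofs.lean`.
-/

noncomputable section

open Real

namespace Literature.Probability.RandomPlanarGeometry.SAW.YangBaxter

/-! ## The defect tilings of the column exchange -/

/-! ### Complexes from a side table -/

namespace Cx

variable {F E : Type*} [DecidableEq E]

open Classical in
/-- **The complex with a given side table** (and angles): `sideOf` is read off the table and
`commonFace e e'` is THE face having both as sides, if any. [folklore] -/
def ofSides (side : F → Side → E) (angle : F → ℝ) : Cx F E where
  side := side
  sideOf f e :=
    if side f .W = e then some .W else if side f .E = e then some .E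
    else if side f .S = e then some .S else if side f .N = e then some .N else none
  commonFace e e' :=
    if h : ∃ f, e ≠ e' ∧ (∃ s, side f s = e) ∧ ∃ t, side f t = e' then some (Classical.choose h) else none
  angle := angle

/-- The complex of a side table is lawful as soon as the four sides of a face are distinct and two
distinct faces share at most one edge. [folklore] -/
theorem ofSides_lawful {side : F → Side → E} (angle : F → ℝ) (hinj : ∀ f, Function.Injective (side f))
    (huniq : ∀ (f g : F) (e e' : E), e ≠ e' → (∃ s, side f s = e) → (∃ t, side f t = e') →
      (∃ s, side g s = e) → (∃ t, side g t = e') → f = g) :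
    (ofSides side angle).Lawful where
  sideOf_eq_some_iff f e s := by
    simp only [ofSides]
    split_ifs with h1 h2 h3 h4
    · exact ⟨fun h => Option.some.inj h ▸ h1, fun h => by rw [hinj f (h1.trans h.symm)]⟩
    · exact ⟨fun h => Option.some.inj h ▸ h2, fun h => by rw [hinj f (h2.trans h.symm)]⟩
    · exact ⟨fun h => Option.some.inj h ▸ h3, fun h => by rw [hinj f (h3.trans h.symm)]⟩
    · exact ⟨fun h => Option.some.inj h ▸ h4, fun h => by rw [hinj f (h4.trans h.symm)]⟩
    · refine ⟨fun h => h.elim, fun h => ?_⟩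
      cases s
      exacts [absurd h h1, absurd h h2, absurd h h3, absurd h h4]
  commonFace_eq_some_iff e e' f := by
    classical
    simp only [ofSides]
    split_ifs with h
    · have hspec := Classical.choose_spec h
      constructor
      · intro hf
        rw [Option.some.injEq] at hf
        rw [← hf]
        exact hspec
      · rintro ⟨hne, hs, ht⟩
        rw [Option.some.injEq]
        exact huniq _ _ e e' hne hspec.2.1 hspec.2.2 hs ht
    · exact ⟨fun h' => h'.elim, fun h' => absurd ⟨f, h'⟩ h⟩

/-- The side table of `ofSides`. [folklore] -/
@[simp] theorem ofSides_side (side : F → Side → E) (angle : F → ℝ) : (ofSides side angle).side = side := rfl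

/-- The angles of `ofSides`. [folklore] -/
@[simp] theorem ofSides_angle (side : F → Side → E) (angle : F → ℝ) : (ofSides side angle).angle = angle := rfl

end Cx

/-! ### The defect complexes `D_h` -/

/-- The faces of the defect tilings: the grid faces and the added rhombus `r`. [cite: GlazmanManolescu2019, §4.2 (D_0, …, D_{2L})] -/
abbrev DFace : Type := Face ⊕ Unit

/-- The edges of the defect tilings: the grid edges and (two of) four extra names for the upper
sides of the added rhombus. [cite: GlazmanManolescu2019, §4.2] -/
abbrev DEdge : Type := MidEdge ⊕ Side

/-- The added rhombus `r`. [cite: GlazmanManolescu2019, §4.2 ("adding a rhombus r")] -/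
def rFace : DFace := Sum.inr ()

/-- The upper-left side of the added rhombus. [cite: GlazmanManolescu2019, §4.2] -/
def ρN : DEdge := Sum.inr .N

/-- The upper-right side of the added rhombus. [cite: GlazmanManolescu2019, §4.2] -/
def ρE : DEdge := Sum.inr .E

/-- **The side table of the defect tiling `D_h`** (columns `i, i+1`, defect at height `h`): the
added rhombus `r` sits between the rows `h − 1` and `h` of the double column — its lower sides are
the tops `slant i h`, `slant (i+1) h` of the faces `(i, h−1)`, `(i+1, h−1)` (as `r`'s sides `W`,
`S`), its upper sides `ρN`, `ρE` (as `N`, `E`; so that its `θ`-corners `N ∩ W`, `S ∩ E` are its left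
and right vertices) are the bottoms of the faces `(i, h)`, `(i+1, h)`; all other sides are those of
the grid. [cite: GlazmanManolescu2019, §4.2 and Fig. 6] -/
def dside (i h : ℤ) : DFace → Side → DEdge
  | .inr _, .W => .inl (.slant i h)
  | .inr _, .S => .inl (.slant (i + 1) h)
  | .inr _, .N => ρN
  | .inr _, .E => ρE
  | .inl f, s => if f = (i, h) ∧ s = .S then ρN else if f = (i + 1, h) ∧ s = .S then ρE else .inl (f.side s)

/-- **The angles of `D_h`**: above the defect (rows `≥ h`) the angles of the columns `i` and `i + 1`
are exchanged; the added rhombus has angle `θ_{i+1} − θ_i`. [cite: GlazmanManolescu2019, §4.2] -/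
def dangle (Θ : ℤ → ℝ) (i h : ℤ) : DFace → ℝ
  | .inr _ => Θ (i + 1) - Θ i
  | .inl f => if h ≤ f.2 then Θ (Equiv.swap i (i + 1) f.1) else Θ f.1

/-- **The defect tiling `D_h`** as a rhombic complex. [cite: GlazmanManolescu2019, §4.2 (D_0, …, D_{2L})] -/
def defCx (Θ : ℤ → ℝ) (i h : ℤ) : Cx DFace DEdge := Cx.ofSides (dside i h) (dangle Θ i h)

section DefectLawful

variable (i h : ℤ)

/-- A grid-named side of a grid face of `D_h` is the grid side. [folklore] -/
theorem dside_inl_eq_inl {f : Face} {s : Side} {e : MidEdge} (hs : dside i h (.inl f) s = .inl e) : f.side s = e := by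
  simp only [dside] at hs
  split_ifs at hs with h1 h2
  · cases hs
  · cases hs
  · exact Sum.inl_injective hs

/-- The face of `D_h` below `ρN`. [folklore] -/
theorem dside_inl_eq_ρN {f : Face} {s : Side} (hs : dside i h (.inl f) s = ρN) : f = (i, h) ∧ s = .S := by
  simp only [dside] at hs
  split_ifs at hs with h1 h2
  · exact h1
  · cases hs
  · cases hs

/-- The face of `D_h` below `ρE`. [folklore] -/
theorem dside_inl_eq_ρE {f : Face} {s : Side} (hs : dside i h (.inl f) s = ρE) : f = (i + 1, h) ∧ s = .S := by
  simp only [dside] at hs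
  split_ifs at hs with h1 h2
  · cases hs
  · exact h2
  · cases hs

/-- The sides of a face of `D_h` are distinct. [folklore] -/
theorem dside_injective (f : DFace) : Function.Injective (dside i h f) := by
  intro s t hst
  rcases f with f | u
  · by_contra hne
    rcases hs : dside i h (.inl f) s with e | x
    · have h1 := dside_inl_eq_inl i h hs
      rw [hst] at hs
      have h2 := dside_inl_eq_inl i h hs
      exact hne (Face.side_injective f (h1.trans h2.symm))
    · have hx : dside i h (.inl f) s = ρN ∨ dside i h (.inl f) s = ρE := by
        rw [hs]; simp only [dside] at hs
        split_ifs at hs with c1 c2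
        · exact Or.inl hs.symm
        · exact Or.inr hs.symm
      rcases hx with hx | hx
      · have h1 := (dside_inl_eq_ρN i h hx).2
        rw [hst] at hx
        exact hne (h1.trans (dside_inl_eq_ρN i h hx).2.symm)
      · have h1 := (dside_inl_eq_ρE i h hx).2
        rw [hst] at hx
        exact hne (h1.trans (dside_inl_eq_ρE i h hx).2.symm)
  · cases s <;> cases t <;> simp [dside, ρN, ρE] at hst ⊢

/-- The sides of the added rhombus. [folklore] -/
theorem dside_inr (u : Unit) (s : Side) :
    dside i h (.inr u) s = match s with | .W => .inl (.slant i h) | .S => .inl (.slant (i + 1) h) | .N => ρN | .E => ρE := by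
  cases s <;> rfl

/-- Which grid faces of `D_h` have the lower-left side of `r` as a side: only `(i, h − 1)`. [folklore] -/
theorem dside_inl_eq_slant_left {f : Face} {s : Side} (hs : dside i h (.inl f) s = .inl (.slant i h)) :
    f = (i, h - 1) ∧ s = .N := by
  have h1 := dside_inl_eq_inl i h hs
  obtain ⟨k, j⟩ := f
  have hS : ¬((k, j) = (i, h) ∧ s = .S) := by
    rintro ⟨hc, rfl⟩
    rw [hc] at hs
    simp [dside, ρN] at hs
  cases s <;> simp [Face.side] at h1
  · exact absurd ⟨by rw [h1.1, h1.2], rfl⟩ hS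
  · exact ⟨by rw [Prod.mk.injEq]; omega, rfl⟩

/-- Which grid faces of `D_h` have the lower-right side of `r` as a side: only `(i+1, h − 1)`. [folklore] -/
theorem dside_inl_eq_slant_right {f : Face} {s : Side} (hs : dside i h (.inl f) s = .inl (.slant (i + 1) h)) :
    f = (i + 1, h - 1) ∧ s = .N := by
  have h1 := dside_inl_eq_inl i h hs
  obtain ⟨k, j⟩ := f
  have hS : ¬((k, j) = (i + 1, h) ∧ s = .S) := by
    rintro ⟨hc, rfl⟩
    rw [hc] at hs
    simp [dside, ρE] at hs
  cases s <;> simp [Face.side] at h1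
  · exact absurd ⟨by rw [h1.1, h1.2], rfl⟩ hS
  · exact ⟨by rw [Prod.mk.injEq]; omega, rfl⟩

/-- **Two distinct faces of `D_h` share at most one edge.** [folklore] -/
theorem dside_uniq (f g : DFace) (e e' : DEdge) (hne : e ≠ e') (hfe : ∃ s, dside i h f s = e)
    (hfe' : ∃ t, dside i h f t = e') (hge : ∃ s, dside i h g s = e) (hge' : ∃ t, dside i h g t = e') : f = g := by
  -- a grid face and the grid: two shared grid-named edges determine the face
  have grid : ∀ (f₀ g₀ : Face) (e₀ e₀' : MidEdge), e₀ ≠ e₀' → (∃ s, f₀.side s = e₀) → (∃ t, f₀.side t = e₀') →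
      (∃ s, g₀.side s = e₀) → (∃ t, g₀.side t = e₀') → f₀ = g₀ := by
    intro f₀ g₀ e₀ e₀' hne₀ h1 h2 h3 h4
    have hf := (MidEdge.commonFace_eq_some_iff e₀ e₀' f₀).2 ⟨hne₀, h1, h2⟩
    have hg := (MidEdge.commonFace_eq_some_iff e₀ e₀' g₀).2 ⟨hne₀, h3, h4⟩
    rw [hf] at hg
    exact Option.some_injective _ hg
  -- the faces having a given special edge as a side
  have whoN : ∀ (f : DFace) (s : Side), dside i h f s = ρN → f = rFace ∨ f = .inl (i, h) := by
    rintro (f | u) s hs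
    · exact Or.inr (by rw [(dside_inl_eq_ρN i h hs).1])
    · exact Or.inl rfl
  have whoE : ∀ (f : DFace) (s : Side), dside i h f s = ρE → f = rFace ∨ f = .inl (i + 1, h) := by
    rintro (f | u) s hs
    · exact Or.inr (by rw [(dside_inl_eq_ρE i h hs).1])
    · exact Or.inl rfl
  have whoL : ∀ (f : DFace) (s : Side), dside i h f s = .inl (.slant i h) → f = rFace ∨ f = .inl (i, h - 1) := by
    rintro (f | u) s hs
    · exact Or.inr (by rw [(dside_inl_eq_slant_left i h hs).1])
    · exact Or.inl rfl
  have whoR : ∀ (f : DFace) (s : Side), dside i h f s = .inl (.slant (i + 1) h) → f = rFace ∨ f = .inl (i + 1, h - 1) := by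
    rintro (f | u) s hs
    · exact Or.inr (by rw [(dside_inl_eq_slant_right i h hs).1])
    · exact Or.inl rfl
  -- the sides of the four faces around `r`
  have sides_ih : ∀ s, dside i h (.inl (i, h)) s ≠ ρE ∧ dside i h (.inl (i, h)) s ≠ .inl (.slant i h) ∧
      dside i h (.inl (i, h)) s ≠ .inl (.slant (i + 1) h) := by
    intro s; cases s <;> simp [dside, ρN, ρE, Face.side]
  have sides_i1h : ∀ s, dside i h (.inl (i + 1, h)) s ≠ ρN ∧ dside i h (.inl (i + 1, h)) s ≠ .inl (.slant i h) ∧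
      dside i h (.inl (i + 1, h)) s ≠ .inl (.slant (i + 1) h) := by
    intro s; cases s <;> simp [dside, ρN, ρE, Face.side]
  have sides_ih1 : ∀ s, dside i h (.inl (i, h - 1)) s ≠ ρN ∧ dside i h (.inl (i, h - 1)) s ≠ ρE ∧
      dside i h (.inl (i, h - 1)) s ≠ .inl (.slant (i + 1) h) := by
    intro s; cases s <;> simp [dside, ρN, ρE, Face.side]
  have sides_i1h1 : ∀ s, dside i h (.inl (i + 1, h - 1)) s ≠ ρN ∧ dside i h (.inl (i + 1, h - 1)) s ≠ ρE ∧
      dside i h (.inl (i + 1, h - 1)) s ≠ .inl (.slant i h) := by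
    intro s; cases s <;> simp [dside, ρN, ρE, Face.side]
  obtain ⟨s, hs⟩ := hfe; obtain ⟨t, ht⟩ := hfe'; obtain ⟨s', hs'⟩ := hge; obtain ⟨t', ht'⟩ := hge'
  rcases f with f₀ | u <;> rcases g with g₀ | u'
  · -- two grid faces
    rcases e with e₀ | x
    · rcases e' with e₀' | x'
      · exact congrArg Sum.inl (grid f₀ g₀ e₀ e₀' (fun h => hne (by rw [h]))
          ⟨s, dside_inl_eq_inl i h hs⟩ ⟨t, dside_inl_eq_inl i h ht⟩
          ⟨s', dside_inl_eq_inl i h hs'⟩ ⟨t', dside_inl_eq_inl i h ht'⟩)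
      · -- `e'` is `ρN` or `ρE`
        have hx : Sum.inr x' = ρN ∨ Sum.inr x' = ρE := by
          have := ht; simp only [dside] at this
          split_ifs at this with c1 c2
          · exact Or.inl this.symm
          · exact Or.inr this.symm
        rcases hx with hx | hx <;> rw [hx] at ht ht'
        · rw [(dside_inl_eq_ρN i h ht).1, (dside_inl_eq_ρN i h ht').1]
        · rw [(dside_inl_eq_ρE i h ht).1, (dside_inl_eq_ρE i h ht').1]
    · have hx : Sum.inr x = ρN ∨ Sum.inr x = ρE := by
        have := hs; simp only [dside] at this
        split_ifs at this with c1 c2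
        · exact Or.inl this.symm
        · exact Or.inr this.symm
      rcases hx with hx | hx <;> rw [hx] at hs hs'
      · rw [(dside_inl_eq_ρN i h hs).1, (dside_inl_eq_ρN i h hs').1]
      · rw [(dside_inl_eq_ρE i h hs).1, (dside_inl_eq_ρE i h hs').1]
  · -- grid face and `r`: impossible
    exfalso
    have key : ∀ (e₁ : DEdge) (s₁ t₁ : Side), dside i h (.inr u') s₁ = e₁ → dside i h (.inl f₀) t₁ = e₁ →
        (f₀ = (i, h) ∧ e₁ = ρN) ∨ (f₀ = (i + 1, h) ∧ e₁ = ρE) ∨ (f₀ = (i, h - 1) ∧ e₁ = .inl (.slant i h)) ∨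
          (f₀ = (i + 1, h - 1) ∧ e₁ = .inl (.slant (i + 1) h)) := by
      intro e₁ s₁ t₁ h1 h2
      cases s₁ <;> simp only [dside] at h1 <;> subst h1
      · exact Or.inr (Or.inr (Or.inl ⟨(dside_inl_eq_slant_left i h h2).1, rfl⟩))
      · exact Or.inr (Or.inl ⟨(dside_inl_eq_ρE i h h2).1, rfl⟩)
      · exact Or.inr (Or.inr (Or.inr ⟨(dside_inl_eq_slant_right i h h2).1, rfl⟩))
      · exact Or.inl ⟨(dside_inl_eq_ρN i h h2).1, rfl⟩
    rcases key e s' s hs' hs with ⟨rfl, rfl⟩ | ⟨rfl, rfl⟩ | ⟨rfl, rfl⟩ | ⟨rfl, rfl⟩ <;>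
      rcases key e' t' t ht' ht with ⟨h1, rfl⟩ | ⟨h1, rfl⟩ | ⟨h1, rfl⟩ | ⟨h1, rfl⟩ <;>
      first
        | exact hne rfl
        | exact (sides_ih t).1 ht
        | exact (sides_ih t).2.1 ht
        | exact (sides_ih t).2.2 ht
        | exact (sides_i1h t).1 ht
        | exact (sides_i1h t).2.1 ht
        | exact (sides_i1h t).2.2 ht
        | exact (sides_ih1 t).1 ht
        | exact (sides_ih1 t).2.1 ht
        | exact (sides_ih1 t).2.2 ht
        | exact (sides_i1h1 t).1 ht
        | exact (sides_i1h1 t).2.1 ht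
        | exact (sides_i1h1 t).2.2 ht
  · exfalso
    have key : ∀ (e₁ : DEdge) (s₁ t₁ : Side), dside i h (.inr u) s₁ = e₁ → dside i h (.inl g₀) t₁ = e₁ →
        (g₀ = (i, h) ∧ e₁ = ρN) ∨ (g₀ = (i + 1, h) ∧ e₁ = ρE) ∨ (g₀ = (i, h - 1) ∧ e₁ = .inl (.slant i h)) ∨
          (g₀ = (i + 1, h - 1) ∧ e₁ = .inl (.slant (i + 1) h)) := by
      intro e₁ s₁ t₁ h1 h2
      cases s₁ <;> simp only [dside] at h1 <;> subst h1
      · exact Or.inr (Or.inr (Or.inl ⟨(dside_inl_eq_slant_left i h h2).1, rfl⟩))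
      · exact Or.inr (Or.inl ⟨(dside_inl_eq_ρE i h h2).1, rfl⟩)
      · exact Or.inr (Or.inr (Or.inr ⟨(dside_inl_eq_slant_right i h h2).1, rfl⟩))
      · exact Or.inl ⟨(dside_inl_eq_ρN i h h2).1, rfl⟩
    rcases key e s s' hs hs' with ⟨rfl, rfl⟩ | ⟨rfl, rfl⟩ | ⟨rfl, rfl⟩ | ⟨rfl, rfl⟩ <;>
      rcases key e' t t' ht ht' with ⟨h1, rfl⟩ | ⟨h1, rfl⟩ | ⟨h1, rfl⟩ | ⟨h1, rfl⟩ <;>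
      first
        | exact hne rfl
        | exact (sides_ih t').1 ht'
        | exact (sides_ih t').2.1 ht'
        | exact (sides_ih t').2.2 ht'
        | exact (sides_i1h t').1 ht'
        | exact (sides_i1h t').2.1 ht'
        | exact (sides_i1h t').2.2 ht'
        | exact (sides_ih1 t').1 ht'
        | exact (sides_ih1 t').2.1 ht'
        | exact (sides_ih1 t').2.2 ht'
        | exact (sides_i1h1 t').1 ht'
        | exact (sides_i1h1 t').2.1 ht'
        | exact (sides_i1h1 t').2.2 ht'
  · cases u; cases u'; rfl

/-- **`D_h` is a lawful complex.** [folklore] -/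
theorem defCx_lawful (Θ : ℤ → ℝ) : (defCx Θ i h).Lawful :=
  Cx.ofSides_lawful _ (dside_injective i h) (dside_uniq i h)

end DefectLawful

/-! ### The faces around an edge of `D_h` -/

section DefectFaces

variable (i h : ℤ)

/-- The faces of `D_h` having a given vertical grid edge as a side. [folklore] -/
theorem faces_of_dside_vert {f : DFace} {s : Side} {k j : ℤ} (hs : dside i h f s = .inl (.vert k j)) :
    f = .inl (k - 1, j) ∨ f = .inl (k, j) := by
  rcases f with f₀ | u
  · have h1 := dside_inl_eq_inl i h hs
    rcases (Face.exists_side_eq_iff f₀ (.vert k j)).1 ⟨s, h1⟩ with h2 | h2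
    · exact Or.inl (by rw [h2]; rfl)
    · exact Or.inr (by rw [h2]; rfl)
  · cases s <;> simp [dside, ρN, ρE] at hs

/-- The faces of `D_h` having a given slanted grid edge as a side (coarse form). [folklore] -/
theorem faces_of_dside_slant {f : DFace} {s : Side} {k j : ℤ} (hs : dside i h f s = .inl (.slant k j)) :
    f = rFace ∨ f = .inl (k, j - 1) ∨ f = .inl (k, j) := by
  rcases f with f₀ | u
  · have h1 := dside_inl_eq_inl i h hs
    rcases (Face.exists_side_eq_iff f₀ (.slant k j)).1 ⟨s, h1⟩ with h2 | h2
    · exact Or.inr (Or.inl (by rw [h2]; rfl))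
    · exact Or.inr (Or.inr (by rw [h2]; rfl))
  · exact Or.inl (by cases u; rfl)

/-- The faces of `D_h` having `ρN` as a side. [folklore] -/
theorem faces_of_dside_ρN {f : DFace} {s : Side} (hs : dside i h f s = ρN) : f = rFace ∨ f = .inl (i, h) := by
  rcases f with f₀ | u
  · exact Or.inr (by rw [(dside_inl_eq_ρN i h hs).1])
  · exact Or.inl (by cases u; rfl)

/-- The faces of `D_h` having `ρE` as a side. [folklore] -/
theorem faces_of_dside_ρE {f : DFace} {s : Side} (hs : dside i h f s = ρE) : f = rFace ∨ f = .inl (i + 1, h) := by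
  rcases f with f₀ | u
  · exact Or.inr (by rw [(dside_inl_eq_ρE i h hs).1])
  · exact Or.inl (by cases u; rfl)

/-- The faces of `D_h` having the lower-left side of `r` as a side. [folklore] -/
theorem faces_of_dside_slant_left {f : DFace} {s : Side} (hs : dside i h f s = .inl (.slant i h)) :
    f = rFace ∨ f = .inl (i, h - 1) := by
  rcases f with f₀ | u
  · exact Or.inr (by rw [(dside_inl_eq_slant_left i h hs).1])
  · exact Or.inl (by cases u; rfl)

/-- The faces of `D_h` having the lower-right side of `r` as a side. [folklore] -/
theorem faces_of_dside_slant_right {f : DFace} {s : Side} (hs : dside i h f s = .inl (.slant (i + 1) h)) :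
    f = rFace ∨ f = .inl (i + 1, h - 1) := by
  rcases f with f₀ | u
  · exact Or.inr (by rw [(dside_inl_eq_slant_right i h hs).1])
  · exact Or.inl (by cases u; rfl)

/-- A generic side of a grid face of `D_h`. [folklore] -/
theorem dside_inl_of_not {f : Face} {s : Side} (h1 : ¬(f = (i, h) ∧ s = .S)) (h2 : ¬(f = (i + 1, h) ∧ s = .S)) :
    dside i h (.inl f) s = .inl (f.side s) := by
  simp only [dside, if_neg h1, if_neg h2]

end DefectFaces

/-! ### The hexagon of the move `D_h → D_{h−1}` -/

section Move

variable (T : ℕ) (L : ℕ) (Θ : ℤ → ℝ) (i h : ℤ)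

/-- The domain of the defect tilings: the rectangle `Rect_{T,L}` and the added rhombus.
[cite: GlazmanManolescu2019, §4.2 ("the graph obtained by adding a rhombus r to Rect_{T,L}(Θ)")] -/
def defDom : Set DFace := Sum.inl '' rect T L ∪ {rFace}

/-- The hexagon re-tiled by the move: the added rhombus and the two faces below it.
[cite: GlazmanManolescu2019, §4.2 ("the added rhombus and the two rhombi adjacent to it … form a hexagon")] -/
def moveH : Finset DFace := {rFace, .inl (i, h - 1), .inl (i + 1, h - 1)}

/-- The interior edges of that hexagon. [cite: GlazmanManolescu2019, §4.2] -/
def moveInt : Finset DEdge := {.inl (.slant i h), .inl (.slant (i + 1) h), .inl (.vert (i + 1) (h - 1))}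

/-- The boundary edges of that hexagon. [cite: GlazmanManolescu2019, §4.2] -/
def moveBd : Finset DEdge :=
  {ρN, ρE, .inl (.vert i (h - 1)), .inl (.slant i (h - 1)), .inl (.slant (i + 1) (h - 1)), .inl (.vert (i + 2) (h - 1))}

/-- The domain is finite. [cite: GlazmanManolescu2019, §2.1] -/
theorem defDom_finite : (defDom T L).Finite := ((rect_finite T L).image _).union (Set.finite_singleton _)

variable {T L i h}

/-- Interior and boundary edges of the hexagon are distinct. [folklore] -/
theorem not_mem_moveBd_of_mem_moveInt {e : DEdge} (he : e ∈ moveInt i h) : e ∉ moveBd i h := by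
  intro hb
  simp only [moveInt, Finset.mem_insert, Finset.mem_singleton] at he
  simp only [moveBd, Finset.mem_insert, Finset.mem_singleton, ρN, ρE] at hb
  rcases he with rfl | rfl | rfl
  · simp at hb; omega
  · simp at hb; omega
  · simp at hb

/-- **The hexagon of the move is a piece of `D_h` in the sense of `Cx.SubCx`.** [cite: GlazmanManolescu2019, §4.2] -/
theorem defCx_subCx (hi : 0 ≤ i) (hiT : i + 2 ≤ T) (hh : -(L : ℤ) ≤ h - 1) (hh' : h - 1 ≤ L) :
    (defCx Θ i h).SubCx (defDom T L) (moveH i h) (moveInt i h) (moveBd i h) where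
  subset f hf := by
    simp only [moveH, Finset.mem_insert, Finset.mem_singleton] at hf
    rcases hf with rfl | rfl | rfl
    · exact Or.inr rfl
    · exact Or.inl ⟨(i, h - 1), ⟨hi, by omega, hh, hh'⟩, rfl⟩
    · exact Or.inl ⟨(i + 1, h - 1), ⟨by omega, by omega, hh, hh'⟩, rfl⟩
  disjoint e he := not_mem_moveBd_of_mem_moveInt he
  int_faces e he f s hs := by
    change dside i h f s = e at hs
    simp only [moveH, Finset.mem_insert, Finset.mem_singleton]
    simp only [moveInt, Finset.mem_insert, Finset.mem_singleton] at he
    rcases he with rfl | rfl | rfl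
    · rcases faces_of_dside_slant_left i h hs with h1 | h1 <;> simp [h1]
    · rcases faces_of_dside_slant_right i h hs with h1 | h1 <;> simp [h1]
    · rcases faces_of_dside_vert i h hs with h1 | h1
      · simp [h1]
      · simp [h1]
  sides_mem f hf s := by
    change dside i h f s ∈ moveInt i h ∨ dside i h f s ∈ moveBd i h
    simp only [moveH, Finset.mem_insert, Finset.mem_singleton] at hf
    rcases hf with rfl | rfl | rfl
    · cases s <;> simp [dside, rFace, ρN, ρE, moveInt, moveBd]
    · cases s <;> simp [dside, ρN, ρE, Face.side, moveInt, moveBd]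
    · cases s <;> simp [dside, ρN, ρE, Face.side, moveInt, moveBd, add_assoc, one_add_one_eq_two]
  bd_unique e he f hf f' hf' hs ht := by
    obtain ⟨s, hs⟩ := hs; obtain ⟨t, ht⟩ := ht
    change dside i h f s = e at hs; change dside i h f' t = e at ht
    by_contra hne
    -- two distinct faces of the hexagon share only interior edges
    have key : ∀ (g g' : DFace), g ∈ moveH i h → g' ∈ moveH i h → g ≠ g' → ∀ (s t : Side),
        dside i h g s = dside i h g' t → dside i h g s ∈ moveInt i h := by
      intro g g' hg hg' hgg' s t hst
      simp only [moveH, Finset.mem_insert, Finset.mem_singleton] at hg hg'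
      rcases hg with rfl | rfl | rfl <;> rcases hg' with rfl | rfl | rfl <;>
        first
        | exact absurd rfl hgg'
        | (cases s <;> cases t <;> simp [dside, rFace, ρN, ρE, Face.side, moveInt] at hst ⊢ <;> omega)
    have hint := key f f' hf hf' hne s t (hs.trans ht.symm)
    rw [hs] at hint
    exact not_mem_moveBd_of_mem_moveInt hint he
  bd_outside e he e' he' hne f hf hs ht := by
    obtain ⟨s, hs⟩ := hs; obtain ⟨t, ht⟩ := ht
    change dside i h f s = e at hs; change dside i h f t = e' at ht
    simp only [moveH, Finset.mem_insert, Finset.mem_singleton, not_or] at hf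
    obtain ⟨hf1, hf2, hf3⟩ := hf
    -- the face outside `H` bordering each boundary edge
    have cand : ∀ (e₁ : DEdge) (s₁ : Side), e₁ ∈ moveBd i h → dside i h f s₁ = e₁ →
        (e₁ = ρN ∧ f = .inl (i, h)) ∨ (e₁ = ρE ∧ f = .inl (i + 1, h)) ∨
        (e₁ = .inl (.vert i (h - 1)) ∧ f = .inl (i - 1, h - 1)) ∨ (e₁ = .inl (.slant i (h - 1)) ∧ f = .inl (i, h - 2)) ∨
        (e₁ = .inl (.slant (i + 1) (h - 1)) ∧ f = .inl (i + 1, h - 2)) ∨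
        (e₁ = .inl (.vert (i + 2) (h - 1)) ∧ f = .inl (i + 2, h - 1)) := by
      intro e₁ s₁ he₁ hs₁
      simp only [moveBd, Finset.mem_insert, Finset.mem_singleton] at he₁
      rcases he₁ with rfl | rfl | rfl | rfl | rfl | rfl
      · rcases faces_of_dside_ρN i h hs₁ with h1 | h1
        · exact absurd h1 hf1
        · exact Or.inl ⟨rfl, h1⟩
      · rcases faces_of_dside_ρE i h hs₁ with h1 | h1
        · exact absurd h1 hf1
        · exact Or.inr (Or.inl ⟨rfl, h1⟩)
      · rcases faces_of_dside_vert i h hs₁ with h1 | h1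
        · exact Or.inr (Or.inr (Or.inl ⟨rfl, h1⟩))
        · exact absurd h1 hf2
      · rcases faces_of_dside_slant i h hs₁ with h1 | h1 | h1
        · exact absurd h1 hf1
        · exact Or.inr (Or.inr (Or.inr (Or.inl ⟨rfl, by rw [h1]; congr 2; omega⟩)))
        · exact absurd h1 hf2
      · rcases faces_of_dside_slant i h hs₁ with h1 | h1 | h1
        · exact absurd h1 hf1
        · exact Or.inr (Or.inr (Or.inr (Or.inr (Or.inl ⟨rfl, by rw [h1]; congr 2; omega⟩))))
        · exact absurd h1 hf3
      · rcases faces_of_dside_vert i h hs₁ with h1 | h1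
        · exact absurd (by rw [h1]; congr 2; omega) hf3
        · exact Or.inr (Or.inr (Or.inr (Or.inr (Or.inr ⟨rfl, h1⟩))))
    rcases cand e s he hs with ⟨rfl, h1⟩ | ⟨rfl, h1⟩ | ⟨rfl, h1⟩ | ⟨rfl, h1⟩ | ⟨rfl, h1⟩ | ⟨rfl, h1⟩ <;>
      rcases cand e' t he' ht with ⟨rfl, h2⟩ | ⟨rfl, h2⟩ | ⟨rfl, h2⟩ | ⟨rfl, h2⟩ | ⟨rfl, h2⟩ | ⟨rfl, h2⟩ <;>
      first
      | exact hne rfl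
      | (rw [h1] at h2; simp at h2; done)
      | (rw [h1] at h2; simp at h2; omega)

end Move

/-! ### The move `D_h → D_{h−1}`: the re-tiled complex and the embeddings of the two hexagons -/

section MoveEmb

variable (Θ : ℤ → ℝ) (i h : ℤ)

/-- The re-labelling of edges identifying `D_{h−1}` with "`D_h` re-tiled inside the hexagon": it
exchanges `ρN ↔ slant i h` and `ρE ↔ slant (i+1) h`. [cite: GlazmanManolescu2019, §4.2] -/
def moveψ : DEdge ≃ DEdge :=
  (Equiv.swap ρN (.inl (.slant i h))).trans (Equiv.swap ρE (.inl (.slant (i + 1) h)))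

/-- **The re-tiled complex**: `D_{h−1}` with its edges re-labelled so as to agree with `D_h` outside
the hexagon. [cite: GlazmanManolescu2019, §4.2 ("Call D_1 the resulting graph")] -/
def moveCx : Cx DFace DEdge := (defCx Θ i (h - 1)).relabel (moveψ i h)

/-- `moveψ` on `ρN`. [folklore] -/
@[simp] theorem moveψ_ρN : moveψ i h ρN = .inl (.slant i h) := by
  simp [moveψ, Equiv.swap_apply_def, ρN, ρE]

/-- `moveψ` on `ρE`. [folklore] -/
@[simp] theorem moveψ_ρE : moveψ i h ρE = .inl (.slant (i + 1) h) := by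
  simp [moveψ, Equiv.swap_apply_def, ρN, ρE]

/-- `moveψ` on `slant i h`. [folklore] -/
@[simp] theorem moveψ_slant_left : moveψ i h (.inl (.slant i h)) = ρN := by
  simp [moveψ, Equiv.swap_apply_def, ρN, ρE]

/-- `moveψ` on `slant (i+1) h`. [folklore] -/
@[simp] theorem moveψ_slant_right : moveψ i h (.inl (.slant (i + 1) h)) = ρE := by
  have : (MidEdge.slant (i + 1) h) ≠ .slant i h := by simp
  simp [moveψ, Equiv.swap_apply_def, ρN, ρE]

/-- `moveψ` fixes the other edges. [folklore] -/
theorem moveψ_of_ne {e : DEdge} (h1 : e ≠ ρN) (h2 : e ≠ ρE) (h3 : e ≠ .inl (.slant i h))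
    (h4 : e ≠ .inl (.slant (i + 1) h)) : moveψ i h e = e := by
  simp [moveψ, Equiv.swap_apply_def, h1, h2, h3, h4]

/-- `moveψ` fixes the other slanted edges. [folklore] -/
theorem moveψ_slant_of_ne {k j : ℤ} (hk : ¬(k = i ∧ j = h)) (hk' : ¬(k = i + 1 ∧ j = h)) :
    moveψ i h (.inl (.slant k j)) = .inl (.slant k j) :=
  moveψ_of_ne i h (by simp [ρN]) (by simp [ρE]) (by simpa using hk) (by simpa using hk')

/-- `moveψ` fixes vertical edges. [folklore] -/
@[simp] theorem moveψ_vert (k j : ℤ) : moveψ i h (.inl (.vert k j)) = .inl (.vert k j) :=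
  moveψ_of_ne i h (by simp [ρN]) (by simp [ρE]) (by simp) (by simp)

/-- The sides of the re-tiled complex. [folklore] -/
theorem moveCx_side (f : DFace) (s : Side) : (moveCx Θ i h).side f s = moveψ i h (dside i (h - 1) f s) := rfl

/-- The angles of the re-tiled complex. [folklore] -/
theorem moveCx_angle (f : DFace) : (moveCx Θ i h).angle f = dangle Θ i (h - 1) f := rfl

/-- The re-tiled complex is lawful. [folklore] -/
theorem moveCx_lawful : (moveCx Θ i h).Lawful := Cx.relabel_lawful (defCx_lawful i (h - 1) Θ) _

/-- **`D_h` and the re-tiled complex agree outside the hexagon: sides.** [cite: GlazmanManolescu2019, §4.2 ("coincides with Ω everywhere except for H")] -/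
theorem moveCx_side_of_not_mem {f : DFace} (hf : f ∉ moveH i h) (s : Side) :
    (moveCx Θ i h).side f s = (defCx Θ i h).side f s := by
  rw [moveCx_side]
  change moveψ i h (dside i (h - 1) f s) = dside i h f s
  simp only [moveH, Finset.mem_insert, Finset.mem_singleton, not_or] at hf
  obtain ⟨hf1, hf2, hf3⟩ := hf
  rcases f with f | u
  · simp only [Sum.inl.injEq] at hf2 hf3
    have hA : ¬(f = (i, h - 1) ∧ s = .S) := fun hc => hf2 hc.1
    have hB : ¬(f = (i + 1, h - 1) ∧ s = .S) := fun hc => hf3 hc.1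
    rw [dside_inl_of_not i (h - 1) hA hB]
    by_cases h1 : f = (i, h) ∧ s = .S
    · obtain ⟨rfl, rfl⟩ := h1
      rw [show dside i h (.inl (i, h)) .S = ρN by simp [dside]]
      simp [Face.side]
    · by_cases h2 : f = (i + 1, h) ∧ s = .S
      · obtain ⟨rfl, rfl⟩ := h2
        rw [show dside i h (.inl (i + 1, h)) .S = ρE by simp [dside]]
        simp [Face.side]
      · rw [← dside_inl_of_not i h h1 h2]
        exact moveψ_of_ne i h (fun e => h1 (dside_inl_eq_ρN i h e)) (fun e => h2 (dside_inl_eq_ρE i h e))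
          (fun e => hf2 (dside_inl_eq_slant_left i h e).1) (fun e => hf3 (dside_inl_eq_slant_right i h e).1)
  · exact absurd (by cases u; rfl) hf1

/-- **`D_h` and the re-tiled complex agree outside the hexagon: angles.** [cite: GlazmanManolescu2019, §4.2] -/
theorem moveCx_angle_of_not_mem {f : DFace} (hf : f ∉ moveH i h) :
    (moveCx Θ i h).angle f = (defCx Θ i h).angle f := by
  rw [moveCx_angle]
  change dangle Θ i (h - 1) f = dangle Θ i h f
  simp only [moveH, Finset.mem_insert, Finset.mem_singleton, not_or] at hf
  obtain ⟨hf1, hf2, hf3⟩ := hf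
  rcases f with ⟨k, j⟩ | u
  · simp only [dangle]
    simp only [Sum.inl.injEq, Prod.mk.injEq, not_and] at hf2 hf3
    by_cases hj : j = h - 1
    · subst hj
      have hk : k ≠ i := fun hk => hf2 hk rfl
      have hk' : k ≠ i + 1 := fun hk' => hf3 hk' rfl
      rw [if_pos le_rfl, if_neg (by omega), Equiv.swap_apply_of_ne_of_ne hk hk']
    · by_cases hle : h ≤ j
      · rw [if_pos (by omega), if_pos hle]
      · rw [if_neg (by omega), if_neg hle]
  · rfl

/-- The map of faces of the two hexagon embeddings. [cite: GlazmanManolescu2019, §4.2] -/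
def moveφF : HFace → DFace
  | .r => rFace
  | .A => .inl (i, h - 1)
  | .B => .inl (i + 1, h - 1)

/-- The map of edges of the two hexagon embeddings (on the interior edges it is the only choice
compatible with both side tables). [cite: GlazmanManolescu2019, §4.2] -/
def moveφE : HEdge → DEdge
  | .TL => ρN
  | .TR => ρE
  | .rhoL => .inl (.slant i h)
  | .rhoR => .inl (.slant (i + 1) h)
  | .Lf => .inl (.vert i (h - 1))
  | .BL => .inl (.slant i (h - 1))
  | .m => .inl (.vert (i + 1) (h - 1))
  | .BR => .inl (.slant (i + 1) (h - 1))
  | .R => .inl (.vert (i + 2) (h - 1))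

/-- `moveφF` is injective. [folklore] -/
theorem moveφF_injective : Function.Injective (moveφF i h) := by
  intro x y hxy
  cases x <;> cases y <;> simp [moveφF, rFace] at hxy ⊢

/-- `moveφE` is injective. [folklore] -/
theorem moveφE_injective : Function.Injective (moveφE i h) := by
  intro x y hxy
  cases x <;> cases y <;> simp [moveφE, ρN, ρE] at hxy ⊢ <;> omega

/-- The faces of the hexagon are the images of `moveφF`. [folklore] -/
theorem mem_moveH_iff (f : DFace) : f ∈ moveH i h ↔ ∃ x, moveφF i h x = f := by
  simp only [moveH, Finset.mem_insert, Finset.mem_singleton]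
  constructor
  · rintro (rfl | rfl | rfl)
    exacts [⟨.r, rfl⟩, ⟨.A, rfl⟩, ⟨.B, rfl⟩]
  · rintro ⟨x, rfl⟩
    cases x <;> simp [moveφF]

/-- Interior edges correspond under `moveφE`. [folklore] -/
theorem moveφE_mem_moveInt_iff (x : HEdge) : moveφE i h x ∈ moveInt i h ↔ x ∈ hexInt := by
  cases x <;> simp [moveφE, moveInt, hexInt, ρN, ρE]

/-- Every interior edge of the hexagon is an image. [folklore] -/
theorem exists_moveφE_of_mem_moveInt {e : DEdge} (he : e ∈ moveInt i h) : ∃ x, moveφE i h x = e := by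
  simp only [moveInt, Finset.mem_insert, Finset.mem_singleton] at he
  rcases he with rfl | rfl | rfl
  exacts [⟨.rhoL, rfl⟩, ⟨.rhoR, rfl⟩, ⟨.m, rfl⟩]

/-- The other edges are mapped to the boundary. [folklore] -/
theorem moveφE_mem_moveBd (x : HEdge) (hx : x ∉ hexInt) : moveφE i h x ∈ moveBd i h := by
  cases x <;> simp [moveφE, moveBd, hexInt] at hx ⊢

/-- **The embedding of the hexagon `H` (the rhombus on top) onto the hexagon of `D_h`.**
[cite: GlazmanManolescu2019, §4.2 and Fig. 6] -/
def embTop : Cx.LocEmb (topHex (Θ i) (Θ (i + 1))) (defCx Θ i h) (moveH i h) (moveInt i h) (moveBd i h) hexInt where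
  φF := moveφF i h
  φE := moveφE i h
  injF := moveφF_injective i h
  injE := moveφE_injective i h
  mem_H := mem_moveH_iff i h
  mem_Int := moveφE_mem_moveInt_iff i h
  int_sub _ he := exists_moveφE_of_mem_moveInt i h he
  mem_Bd := moveφE_mem_moveBd i h
  side_eq x s := by
    change dside i h (moveφF i h x) s = moveφE i h (topTbl x s)
    cases x <;> cases s <;> simp [dside, moveφF, moveφE, topTbl, rFace, Face.side, add_assoc, one_add_one_eq_two]
  angle_eq x := by
    change dangle Θ i h (moveφF i h x) = topAng (Θ i) (Θ (i + 1)) x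
    cases x <;> simp [dangle, moveφF, topAng, rFace]

/-- **The embedding of the hexagon `H'` (the rhombus below) onto the hexagon of the re-tiled
complex.** [cite: GlazmanManolescu2019, §4.2 and Fig. 6] -/
def embBot : Cx.LocEmb (botHex (Θ i) (Θ (i + 1))) (moveCx Θ i h) (moveH i h) (moveInt i h) (moveBd i h) hexInt where
  φF := moveφF i h
  φE := moveφE i h
  injF := moveφF_injective i h
  injE := moveφE_injective i h
  mem_H := mem_moveH_iff i h
  mem_Int := moveφE_mem_moveInt_iff i h
  int_sub _ he := exists_moveφE_of_mem_moveInt i h he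
  mem_Bd := moveφE_mem_moveBd i h
  side_eq x s := by
    rw [moveCx_side]
    change moveψ i h (dside i (h - 1) (moveφF i h x) s) = moveφE i h (botTbl x s)
    cases x <;> cases s <;>
      simp [dside, moveφF, moveφE, botTbl, rFace, Face.side, add_assoc, one_add_one_eq_two, moveψ_slant_of_ne]
  angle_eq x := by
    rw [moveCx_angle]
    change dangle Θ i (h - 1) (moveφF i h x) = botAng (Θ i) (Θ (i + 1)) x
    cases x <;> simp [dangle, moveφF, botAng, rFace]

end MoveEmb

/-! ### One Yang–Baxter move: `G_{D_h} = G_{D_{h−1}}` -/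

namespace Cx

variable {F E : Type*} [DecidableEq F] [DecidableEq E]

omit [DecidableEq F] [DecidableEq E] in
/-- A complex that agrees with a `SubCx` outside `H`, and whose faces of `H` have their sides in
`IntH ∪ ∂H` with boundary edges on one face of `H` only, is a `SubCx` for the same data. [folklore] -/
theorem SubCx.of_agree {K K' : Cx F E} {D : Set F} {H : Finset F} {IntH BdH : Finset E} (hS : K.SubCx D H IntH BdH)
    (hside : ∀ f ∉ H, ∀ s, K'.side f s = K.side f s)
    (hsides : ∀ f ∈ H, ∀ s, K'.side f s ∈ IntH ∨ K'.side f s ∈ BdH)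
    (huniq : ∀ e ∈ BdH, ∀ f ∈ H, ∀ f' ∈ H, (∃ s, K'.side f s = e) → (∃ t, K'.side f' t = e) → f = f') :
    K'.SubCx D H IntH BdH where
  subset := hS.subset
  disjoint := hS.disjoint
  int_faces e he f s hs := by
    by_contra hf
    rw [hside f hf] at hs
    exact hf (hS.int_faces e he f s hs)
  sides_mem := hsides
  bd_unique := huniq
  bd_outside e he e' he' hne f hf hs ht := by
    obtain ⟨s, hs⟩ := hs; obtain ⟨t, ht⟩ := ht
    rw [hside f hf] at hs ht
    exact hS.bd_outside e he e' he' hne f hf ⟨s, hs⟩ ⟨t, ht⟩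

omit [DecidableEq F] in
/-- The list of the endpoints of the gaps of a skeleton satisfying the outside condition has no
repetition (no two consecutive gaps). [folklore] -/
theorem nodup_flatMap_gaps {K : Cx F E} {D : Set F} {H : Finset F} {IntH BdH : Finset E} {a z : E} {o : List E}
    (h : K.OutValid D H IntH BdH a z o) : ((gaps BdH o).flatMap fun p => [p.1, p.2]).Nodup := by
  have hnd := h.nodup
  have htr := h.triple
  clear h
  induction o with
  | nil => simp
  | cons e t ih =>
    cases t with
    | nil => simp
    | cons e' t' =>
      rw [pairsOf_cons_cons] at htr
      have ih' := ih hnd.of_cons htr.tail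
      rw [gaps_cons_cons]
      split_ifs with hg
      · rw [List.flatMap_cons]
        -- the next pair is not a gap, so the remaining gaps are those of the tail of the tail
        have hrest : ∀ x ∈ (gaps BdH (e' :: t')).flatMap (fun p => [p.1, p.2]), x ∈ t' := by
          intro x hx
          cases t' with
          | nil => simp at hx
          | cons e'' t'' =>
            have hng : ¬(e' ∈ BdH ∧ e'' ∈ BdH) := by
              rw [pairsOf_cons_cons, List.isChain_cons_cons] at htr
              exact fun h' => htr.1.1 ⟨hg, h'⟩
            rw [gaps_cons_cons, if_neg hng] at hx
            simp only [List.mem_flatMap, List.mem_cons, List.mem_nil_iff, or_false] at hx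
            obtain ⟨p, hp, hx⟩ := hx
            have := mem_of_mem_pairsOf (gaps_subset _ hp)
            rcases hx with rfl | rfl
            exacts [this.1, this.2]
        have h1 : e ∉ e' :: t' := (List.nodup_cons.1 hnd).1
        have h2 : e' ∉ t' := (List.nodup_cons.1 (List.nodup_cons.1 hnd).2).1
        simp only [List.cons_append, List.nil_append, List.nodup_cons, List.mem_cons]
        refine ⟨?_, fun h' => h2 (hrest _ h'), ih'⟩
        rintro (rfl | h')
        · exact h1 List.mem_cons_self
        · exact h1 (List.mem_cons_of_mem _ (hrest _ h'))
      · exact ih'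

end Cx

section MoveEq

variable {T L : ℕ} {Θ : ℤ → ℝ} {i h : ℤ}

/-- Boundary edges of the hexagon come from non-interior edges of `H`. [folklore] -/
theorem exists_moveφE_of_mem_moveBd (i h : ℤ) {e : DEdge} (he : e ∈ moveBd i h) : ∃ x, x ∉ hexInt ∧ moveφE i h x = e := by
  simp only [moveBd, Finset.mem_insert, Finset.mem_singleton] at he
  rcases he with rfl | rfl | rfl | rfl | rfl | rfl
  exacts [⟨.TL, by decide, rfl⟩, ⟨.TR, by decide, rfl⟩, ⟨.Lf, by decide, rfl⟩, ⟨.BL, by decide, rfl⟩,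
    ⟨.BR, by decide, rfl⟩, ⟨.R, by decide, rfl⟩]

/-- The boundary edges of a hexagon are its non-interior edges. [folklore] -/
theorem HEdge.mem_bd_iff (x : HEdge) : x ∈ HEdge.bd ↔ x ∉ hexInt := by
  cases x <;> decide

/-- In `H'`, a boundary edge is a side of one rhombus only. [folklore] -/
theorem botTbl_bd_unique : ∀ (x x' : HFace) (s t : Side), botTbl x s = botTbl x' t → botTbl x s ∈ hexInt ∨ x = x' := by
  decide

/-- **The re-tiled complex is a `SubCx` for the same hexagon data.** [cite: GlazmanManolescu2019, §4.2] -/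
theorem moveCx_subCx (hi : 0 ≤ i) (hiT : i + 2 ≤ T) (hh : -(L : ℤ) ≤ h - 1) (hh' : h - 1 ≤ L) :
    (moveCx Θ i h).SubCx (defDom T L) (moveH i h) (moveInt i h) (moveBd i h) := by
  refine Cx.SubCx.of_agree (defCx_subCx Θ hi hiT hh hh') (fun f hf s => moveCx_side_of_not_mem Θ i h hf s)
    (fun f hf s => ?_) (fun e he f hf f' hf' hs ht => ?_)
  · obtain ⟨x, rfl⟩ := (mem_moveH_iff i h f).1 hf
    have hside := (embBot Θ i h).side_eq x s
    change (moveCx Θ i h).side (moveφF i h x) s = moveφE i h (botTbl x s) at hside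
    rw [hside]
    by_cases hx : botTbl x s ∈ hexInt
    · exact Or.inl ((moveφE_mem_moveInt_iff i h _).2 hx)
    · exact Or.inr (moveφE_mem_moveBd i h _ hx)
  · obtain ⟨x, rfl⟩ := (mem_moveH_iff i h f).1 hf
    obtain ⟨x', rfl⟩ := (mem_moveH_iff i h f').1 hf'
    obtain ⟨s, hs⟩ := hs; obtain ⟨t, ht⟩ := ht
    have h1 := (embBot Θ i h).side_eq x s
    have h2 := (embBot Θ i h).side_eq x' t
    change (moveCx Θ i h).side (moveφF i h x) s = moveφE i h (botTbl x s) at h1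
    change (moveCx Θ i h).side (moveφF i h x') t = moveφE i h (botTbl x' t) at h2
    rw [h1] at hs; rw [h2] at ht
    have heq : botTbl x s = botTbl x' t := moveφE_injective i h (hs.trans ht.symm)
    rcases botTbl_bd_unique x x' s t heq with hint | rfl
    · exact absurd he (not_mem_moveBd_of_mem_moveInt (hs ▸ (moveφE_mem_moveInt_iff i h _).2 hint))
    · rfl

/-- The denominator of eq. (1) does not vanish on `[π/3, 2π/3]`. [cite: GlazmanManolescu2019, eq. (1)] -/
theorem weightDen_ne_zero_of_mem {θ : ℝ} (hθ : θ ∈ Set.Icc (π / 3) (2 * π / 3)) : weightDen θ ≠ 0 :=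
  (weightDen_neg hθ).ne

/-- The denominator of eq. (1) does not vanish at the angle `θ₂ − θ₁` of the added rhombus.
[cite: GlazmanManolescu2019, eq. (1) and §4.2] -/
theorem weightDen_sub_ne_zero {θ₁ θ₂ : ℝ} (h₁ : θ₁ ∈ Set.Icc (π / 3) (2 * π / 3)) (h₂ : θ₂ ∈ Set.Icc (π / 3) (2 * π / 3)) :
    weightDen (θ₂ - θ₁) ≠ 0 := by
  obtain ⟨a1, b1⟩ := h₁; obtain ⟨a2, b2⟩ := h₂
  have hpi := Real.pi_pos
  rw [weightDen]
  have hneg : Real.sin (5 * π / 4 + 3 * (θ₂ - θ₁) / 8) < 0 := by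
    have : 0 < Real.sin (5 * π / 4 + 3 * (θ₂ - θ₁) / 8 - π) := Real.sin_pos_of_pos_of_lt_pi (by linarith) (by linarith)
    rw [Real.sin_sub_pi] at this
    linarith
  exact mul_ne_zero hneg.ne (Real.sin_pos_of_pos_of_lt_pi (by linarith) (by linarith)).ne'

/-- **The gaps of a skeleton of `D_h` are the image of an admissible gap list of the hexagon.**
[cite: GlazmanManolescu2019, §4.2] -/
theorem exists_admissible_of_outValid {D : Set DFace} {a z : DEdge} {o : List DEdge}
    (hOV : (defCx Θ i h).OutValid D (moveH i h) (moveInt i h) (moveBd i h) a z o) :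
    ∃ P : List (HEdge × HEdge), admissibleB P = true ∧ Cx.gaps (moveBd i h) o = P.map (Prod.map (moveφE i h) (moveφE i h)) := by
  classical
  set g : DEdge → HEdge := Function.invFun (moveφE i h) with hg
  have hginv : ∀ e ∈ moveBd i h, moveφE i h (g e) = e := fun e he => by
    obtain ⟨x, -, hx⟩ := exists_moveφE_of_mem_moveBd i h he
    exact Function.invFun_eq ⟨x, hx⟩
  have hgbd : ∀ e ∈ moveBd i h, g e ∈ HEdge.bd := fun e he => by
    rw [HEdge.mem_bd_iff]
    intro hint
    have := (moveφE_mem_moveInt_iff i h (g e)).2 hint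
    rw [hginv e he] at this
    exact not_mem_moveBd_of_mem_moveInt this he
  refine ⟨(Cx.gaps (moveBd i h) o).map (Prod.map g g), ?_, ?_⟩
  · unfold admissibleB
    simp only [Bool.and_eq_true, List.all_eq_true, decide_eq_true_eq, List.mem_map]
    constructor
    · rintro p ⟨q, hq, rfl⟩
      obtain ⟨h1, h2⟩ := Cx.mem_of_mem_gaps hq
      exact ⟨hgbd _ h1, hgbd _ h2⟩
    · have hnd := Cx.nodup_flatMap_gaps hOV
      have heq : ((Cx.gaps (moveBd i h) o).map (Prod.map g g)).flatMap (fun p => [p.1, p.2]) =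
          ((Cx.gaps (moveBd i h) o).flatMap fun p => [p.1, p.2]).map g := by
        rw [List.flatMap_map, List.map_flatMap]; rfl
      rw [heq]
      refine hnd.map_on fun x hx y hy hxy => ?_
      have hmem : ∀ w ∈ (Cx.gaps (moveBd i h) o).flatMap (fun p => [p.1, p.2]), w ∈ moveBd i h := by
        intro w hw
        simp only [List.mem_flatMap, List.mem_cons, List.mem_nil_iff, or_false] at hw
        obtain ⟨p, hp, rfl | rfl⟩ := hw
        exacts [(Cx.mem_of_mem_gaps hp).1, (Cx.mem_of_mem_gaps hp).2]
      rw [← hginv x (hmem x hx), ← hginv y (hmem y hy), hxy]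
  · rw [List.map_map, eq_comm]
    conv_rhs => rw [← List.map_id (Cx.gaps (moveBd i h) o)]
    refine List.map_congr_left fun p hp => ?_
    obtain ⟨h1, h2⟩ := Cx.mem_of_mem_gaps hp
    obtain ⟨p1, p2⟩ := p
    simp only [Function.comp_apply, Prod.map, id_eq, hginv _ h1, hginv _ h2]

/-- **One move: the partition functions of `D_h` and of the re-tiled complex agree** (Corollary 3.2
with the Yang–Baxter equation for the two hexagons). [cite: GlazmanManolescu2019, §4.2 ("G_{D_0}(a,b) = G_{D_1}(a,b)")] -/
theorem wsum_moveCx_eq (hΘ : ∀ k, Θ k ∈ Set.Icc (π / 3) (2 * π / 3)) (hi : 0 ≤ i) (hiT : i + 2 ≤ T)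
    (hh : -(L : ℤ) ≤ h - 1) (hh' : h - 1 ≤ L) {a z : DEdge} (ha : a ∉ moveInt i h) (hz : z ∉ moveInt i h) :
    (moveCx Θ i h).wsum (defDom T L) a z = (defCx Θ i h).wsum (defDom T L) a z := by
  have hS := defCx_subCx Θ (T := T) (L := L) hi hiT hh hh'
  have hS' := moveCx_subCx (Θ := Θ) (T := T) (L := L) hi hiT hh hh'
  have hK := defCx_lawful i h Θ
  have hK' := moveCx_lawful Θ i h
  refine Cx.wsum_eq_of_Zloc_eq hS hS' hK hK' (fun f hf s => moveCx_side_of_not_mem Θ i h hf s)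
    (fun f hf => moveCx_angle_of_not_mem Θ i h hf) (defDom_finite T L) ha hz fun o hOV => ?_
  obtain ⟨P, hP, hgaps⟩ := exists_admissible_of_outValid hOV
  rw [hgaps]
  change (moveCx Θ i h).Zloc _ _ (P.map (Prod.map (embBot Θ i h).φE (embBot Θ i h).φE)) =
    (defCx Θ i h).Zloc _ _ (P.map (Prod.map (embTop Θ i h).φE (embTop Θ i h).φE))
  rw [(embBot Θ i h).Zloc_map (botHex_lawful _ _) hK' hS', (embTop Θ i h).Zloc_map (topHex_lawful _ _) hK hS]
  exact (Zloc_topHex_eq_botHex (Θ i) (Θ (i + 1)) (weightDen_ne_zero_of_mem (hΘ i))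
    (weightDen_ne_zero_of_mem (hΘ (i + 1))) (weightDen_sub_ne_zero (hΘ i) (hΘ (i + 1))) hP).symm

/-- **One move: `G_{D_h}(a, b) = G_{D_{h−1}}(a, b)`** for boundary points (vertical grid edges).
[cite: GlazmanManolescu2019, §4.2 ("This in effect slides the added rhombus one unit down … G_{D_0}(a,b) = G_{D_1}(a,b)")] -/
theorem wsum_defCx_eq_pred (hΘ : ∀ k, Θ k ∈ Set.Icc (π / 3) (2 * π / 3)) (hi : 0 ≤ i) (hiT : i + 2 ≤ T)
    (hh : -(L : ℤ) ≤ h - 1) (hh' : h - 1 ≤ L) (k j k' j' : ℤ) (hk : k ≠ i + 1) (hk' : k' ≠ i + 1) :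
    (defCx Θ i h).wsum (defDom T L) (.inl (.vert k j)) (.inl (.vert k' j')) =
      (defCx Θ i (h - 1)).wsum (defDom T L) (.inl (.vert k j)) (.inl (.vert k' j')) := by
  have ha : (Sum.inl (MidEdge.vert k j) : DEdge) ∉ moveInt i h := by simp [moveInt, hk]
  have hz : (Sum.inl (MidEdge.vert k' j') : DEdge) ∉ moveInt i h := by simp [moveInt, hk']
  rw [← wsum_moveCx_eq hΘ hi hiT hh hh' ha hz, moveCx,
    ← Cx.wsum_relabel (defCx_lawful i (h - 1) Θ) (moveψ i h) (defDom_finite T L) (Sum.inl (MidEdge.vert k j))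
      (Sum.inl (MidEdge.vert k' j')), moveψ_vert, moveψ_vert]

/-- **Sliding the rhombus all the way down**: `G_{D_{L+1}} = G_{D_{−L}}` (`2L + 1` moves).
[cite: GlazmanManolescu2019, §4.2 ("Performing 2L such Yang–Baxter transformations leads to G_{D_0}(a,b) = G_{D_{2L}}(a,b)")] -/
theorem wsum_defCx_top_eq_bot (hΘ : ∀ k, Θ k ∈ Set.Icc (π / 3) (2 * π / 3)) (hi : 0 ≤ i) (hiT : i + 2 ≤ T)
    (k j k' j' : ℤ) (hk : k ≠ i + 1) (hk' : k' ≠ i + 1) :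
    (defCx Θ i (L + 1)).wsum (defDom T L) (.inl (.vert k j)) (.inl (.vert k' j')) =
      (defCx Θ i (-L)).wsum (defDom T L) (.inl (.vert k j)) (.inl (.vert k' j')) := by
  have key : ∀ n : ℕ, n ≤ 2 * L + 1 →
      (defCx Θ i (L + 1)).wsum (defDom T L) (.inl (.vert k j)) (.inl (.vert k' j')) =
        (defCx Θ i (L + 1 - n)).wsum (defDom T L) (.inl (.vert k j)) (.inl (.vert k' j')) := by
    intro n
    induction n with
    | zero => intro; simp
    | succ n ih =>
      intro hn
      rw [ih (by omega), show (L : ℤ) + 1 - (n + 1 : ℕ) = (L + 1 - n) - 1 by push_cast; ring]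
      exact wsum_defCx_eq_pred hΘ hi hiT (by omega) (by omega) k j k' j' hk hk'
  have := key (2 * L + 1) le_rfl
  rwa [show (L : ℤ) + 1 - (2 * L + 1 : ℕ) = -L by push_cast; ring] at this

end MoveEq

end Literature.Probability.RandomPlanarGeometry.SAW.YangBaxter
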